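import Literature.Barriers.Parity.GoldbachAverageZeros
import Literature.NumberTheory.LFunctions.VonMangoldtLaplaceProgressions
import Literature.NumberTheory.LFunctions.ResidueClassLaplaceBound
import Literature.NumberTheory.Sieve.GranvilleGoldbachProofs
import HarnessLib

/-!
# Bhowmik–Halupczok–Matsumoto–Suzuki, Theorem 1 (2): proofs

Sibling of `Literature/Barriers/Parity/GoldbachAverageZeros.lean` (barrier catalogue `Parity`,
entry `GoldbachAverageZeros`), discharging the named fact
`Literature.Barriers.Parity.BHMS2019_thm1_ii` (`BHMS2019_thm1_ii_holds`) — G. Bhowmik, K. Halupczok, K. Matsumoto,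
Y. Suzuki, *Goldbach representations in arithmetic progressions and zeros of Dirichlet
L-functions*, Mathematika 65 (2019), 57–97 (arXiv:1704.06103), Theorem 1 (2): under the Distinct
Zero Conjecture (DZC) and `χ(a) + χ(b) ≠ 0` for all `χ (mod q)`, the averaged asymptotic
`S(x; q, a, b) = x²/(2φ(q)²) + O_q(x^{1+d+ε})` (all `ε > 0`, `1/2 ≤ d < 1`) forces `B_q ≤ d` or
`B_q = 1`, and `B_q ≤ d` when `a = b`. Everything in this file is PROVED (no named facts, no
definitions).

## The route (Laplace transforms on the real axis instead of the explicit formula)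

The printed proof (§7) runs through the explicit formula for `S(x; q, a, b)` with error
`O(x^{2B_q}(log qx)⁵)` (Theorem 2, ten pages including a Landau–Gonek formula) and the meromorphic
continuation of `∑ G(n; q, a, b) n^{-s}` (Proposition 3); the supplement for `a = b` (§8, an idea
of Ruzsa) is a power-series argument on the circle `|z| = e^{-1/N}`. Here the power series are
used throughout, but only on the positive real axis `z = e^{-t}`, where
`F_a(t) = ∑_{n ≡ a} Λ(n) e^{-nt}` (`laplaceSeries (residueClass a)`) has Mellin transform
`Γ(s) ∑_{n ≡ a} Λ(n) n^{-s}`; with `E_a(t) = F_a(t) − e^{-t}/(φ(q)t)` (Mellin transform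
`Γ(s)(L(Λ_a, s) − φ⁻¹/(s−1))`, holomorphic exactly where no `L(·, χ)` vanishes —
`Literature/NumberTheory/LFunctions/VonMangoldtLaplaceProgressions.lean`):

* (product step, `BHMS.abs_laplace_mul_sub_le`, `BHMS.abs_errLaplace_add_le`; source §8 Step 1 and
  Lemma 13) the hypothesis gives `F_aF_b = φ^{-2}(1−e^{-t})^{-2} + O(t^{-1-d-ε})`, i.e.
  `|E_a + E_b| ≪ t^{-d-ε} + t|E_a||E_b|` on `(0, 1]`;
* (`a = b`, `BHMS.abs_errLaplace_le_of_sq`, `BHMS.zerosRealPartLE_of_self`) `F_a ≥ 0`, so a real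
  square root gives `E_a = O(t^{-d-ε})`, and the Landau step under DZC
  (`Literature.NumberTheory.LFunctions.LaplaceProgressions.apply_inv_add_apply_inv_eq_zero`)
  excludes zeros with `Re ρ > d + ε`: **`B_q ≤ d`** — this is stronger than §8 (which only gives
  `B_q < 1`) and does not use the general case;
* (general `a, b`, `BHMS.zerosRealPartLE_of_laplaceBound`) if `B_q < 1` and some zero has
  `Re ρ > d`, the a-priori bound `E_a, E_b = O(t^{-B_q-η})` (zero-free half-plane `Re s > B_q`)
  makes `t E_aE_b = O(t^{1-2B_q-2η})` with `2B_q + 2η − 1 < B_q`, so `E_a + E_b = O(t^{-θ})` with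
  `θ < B_q`, and the Landau step at a zero with `Re ρ > θ` contradicts `χ(a) + χ(b) ≠ 0`
  (the product `E_aE_b` plays the role of the error term `x^{2B_q}` of Theorem 2).

The a-priori bound is isolated as an explicit hypothesis in `BHMS2019_thm1_ii_of_laplaceBound`
and is proved in `Literature/NumberTheory/LFunctions/ResidueClassLaplaceBound.lean`
(`Literature.NumberTheory.LFunctions.LaplaceProgressions.laplaceBound_of_zeroFree`: Mellin
inversion, a contour shift, and Borel–Carathéodory bounds for `L'/L` in the zero-free region), so
that `BHMS2019_thm1_ii_holds` is unconditional.

## References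

* G. Bhowmik, K. Halupczok, K. Matsumoto, Y. Suzuki, Mathematika 65 (2019), 57–97,
  arXiv:1704.06103: Theorem 1, Proposition 3, §7, §8 (Lemma 13).
* G. Bhowmik, I. Z. Ruzsa, *Average Goldbach and the quasi-Riemann hypothesis*, Anal. Math. 44
  (2018), 51–56, Thm. 2.1 (the power-series method; tree:
  `Literature/NumberTheory/LFunctions/LaplaceSeriesAbelian.lean`, `VonMangoldtLaplace.lean`).
-/

noncomputable section

open Filter Finset Asymptotics Real
open scoped Topology ArithmeticFunction.vonMangoldt

namespace Literature.Barriers.Parity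

namespace BHMS

open Literature.NumberTheory.LFunctions Literature.NumberTheory.LFunctions.LaplaceProgressions
  ArithmeticFunction.vonMangoldt

/-! ### Pair convolutions and the product of two Laplace series -/

variable {u v : ℕ → ℝ}

/-- `|∑_{i+j=n} uᵢ vⱼ| ≤ (n+1)^3` when `|uₙ|, |vₙ| ≤ n + 1`. [folklore] -/
theorem abs_pairConv_le (hu : ∀ n, |u n| ≤ (n : ℝ) + 1) (hv : ∀ n, |v n| ≤ (n : ℝ) + 1) (n : ℕ) :
    |∑ ij ∈ antidiagonal n, u ij.1 * v ij.2| ≤ 1 * ((n : ℝ) + 1) ^ 3 := by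
  have hterm : ∀ ij ∈ antidiagonal n, |u ij.1 * v ij.2| ≤ ((n : ℝ) + 1) ^ 2 := by
    intro ij hij
    rw [Finset.HasAntidiagonal.mem_antidiagonal] at hij
    have hi : (ij.1 : ℝ) ≤ n := by exact_mod_cast hij ▸ Nat.le_add_right ij.1 ij.2
    have hj : (ij.2 : ℝ) ≤ n := by exact_mod_cast hij ▸ Nat.le_add_left ij.2 ij.1
    rw [abs_mul, sq]
    exact mul_le_mul ((hu _).trans (by linarith)) ((hv _).trans (by linarith)) (abs_nonneg _)
      (by positivity)
  calc |∑ ij ∈ antidiagonal n, u ij.1 * v ij.2| ≤ ∑ ij ∈ antidiagonal n, |u ij.1 * v ij.2| :=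
        abs_sum_le_sum_abs _ _
    _ ≤ ∑ _ij ∈ antidiagonal n, ((n : ℝ) + 1) ^ 2 := sum_le_sum hterm
    _ = 1 * ((n : ℝ) + 1) ^ 3 := by
        rw [sum_const, Nat.card_antidiagonal, nsmul_eq_mul]; push_cast; ring

/-- `|∑_{m ≤ n} ∑_{i+j=m} uᵢ vⱼ| ≤ (n+1)^4` when `|uₙ|, |vₙ| ≤ n + 1`. [folklore] -/
theorem abs_pairConvSum_le (hu : ∀ n, |u n| ≤ (n : ℝ) + 1) (hv : ∀ n, |v n| ≤ (n : ℝ) + 1)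
    (n : ℕ) :
    |∑ m ∈ range (n + 1), ∑ ij ∈ antidiagonal m, u ij.1 * v ij.2| ≤ 1 * ((n : ℝ) + 1) ^ 4 := by
  calc |∑ m ∈ range (n + 1), ∑ ij ∈ antidiagonal m, u ij.1 * v ij.2|
      ≤ ∑ m ∈ range (n + 1), |∑ ij ∈ antidiagonal m, u ij.1 * v ij.2| := abs_sum_le_sum_abs _ _
    _ ≤ ∑ _m ∈ range (n + 1), ((n : ℝ) + 1) ^ 3 := by
        refine sum_le_sum fun m hm ↦ (abs_pairConv_le hu hv m).trans ?_
        rw [one_mul]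
        have : (m : ℝ) ≤ n := by exact_mod_cast Nat.lt_succ_iff.mp (mem_range.mp hm)
        gcongr
    _ = 1 * ((n : ℝ) + 1) ^ 4 := by
        rw [sum_const, card_range, nsmul_eq_mul]; push_cast; ring

/-- **`F_u(t) F_v(t) = (1 − e^{-t}) ∑ₙ S_{uv}(n) e^{-nt}`** for `t > 0`, where
`S_{uv}(n) = ∑_{m ≤ n} ∑_{i+j=m} uᵢ vⱼ` (Cauchy product, then summation by parts against the
geometric series; Bhowmik–Halupczok–Matsumoto–Suzuki §8, Step 1: "`(1−z)^{-1}F_{a,q}(z)² = ∑ S(n;q,a,a) zⁿ`",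
here for two residue classes). [cite: BhowmikHalupczokMatsumotoSuzuki2019, §8 Step 1] -/
theorem laplaceSeries_mul (hu : ∀ n, |u n| ≤ (n : ℝ) + 1) (hv : ∀ n, |v n| ≤ (n : ℝ) + 1)
    {t : ℝ} (ht : 0 < t) :
    Summable (fun n : ℕ ↦ (∑ m ∈ range (n + 1), ∑ ij ∈ antidiagonal m, u ij.1 * v ij.2) *
        exp (-t * n)) ∧
      laplaceSeries u t * laplaceSeries v t = (1 - exp (-t)) *
        ∑' n : ℕ, (∑ m ∈ range (n + 1), ∑ ij ∈ antidiagonal m, u ij.1 * v ij.2) * exp (-t * n) := by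
  have hr0 : 0 ≤ exp (-t) := (exp_pos _).le
  have hr1 : exp (-t) < 1 := exp_lt_one_iff.mpr (by linarith)
  have hu_s := summable_abs_mul_exp_of_le (abs_le_one_mul_pow_one hu) ht
  have hv_s := summable_abs_mul_exp_of_le (abs_le_one_mul_pow_one hv) ht
  have hconv_s : Summable fun n : ℕ ↦ ‖(∑ ij ∈ antidiagonal n, u ij.1 * v ij.2) * exp (-t * n)‖ :=
    summable_abs_mul_exp_of_le (B := 1) (k := 3) (abs_pairConv_le hu hv) ht
  have hS_s : Summable fun n : ℕ ↦
      ‖(∑ m ∈ range (n + 1), ∑ ij ∈ antidiagonal m, u ij.1 * v ij.2) * exp (-t * n)‖ :=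
    summable_abs_mul_exp_of_le (B := 1) (k := 4) (abs_pairConvSum_le hu hv) ht
  have hgeom_s : Summable fun n : ℕ ↦ ‖(1 : ℝ) * exp (-t * n)‖ := by
    refine summable_abs_mul_exp_of_le (B := 1) (k := 0) (fun n ↦ ?_) ht
    simp
  refine ⟨hS_s.of_norm, ?_⟩
  have hprod : laplaceSeries u t * laplaceSeries v t =
      ∑' n : ℕ, (∑ ij ∈ antidiagonal n, u ij.1 * v ij.2) * exp (-t * n) := by
    rw [laplaceSeries_def, laplaceSeries_def, tsum_mul_exp_mul_tsum_mul_exp hu_s hv_s]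
  have hgeom : ∑' n : ℕ, (1 : ℝ) * exp (-t * n) = (1 - exp (-t))⁻¹ := by
    simp_rw [one_mul, exp_neg_mul_natCast]
    exact tsum_geometric_of_lt_one hr0 hr1
  have hparts : (∑' n : ℕ, (∑ ij ∈ antidiagonal n, u ij.1 * v ij.2) * exp (-t * n)) *
      (1 - exp (-t))⁻¹ =
      ∑' n : ℕ, (∑ m ∈ range (n + 1), ∑ ij ∈ antidiagonal m, u ij.1 * v ij.2) * exp (-t * n) := by
    rw [← hgeom, tsum_mul_exp_mul_tsum_mul_exp hconv_s hgeom_s]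
    refine tsum_congr fun n ↦ ?_
    congr 1
    rw [Nat.sum_antidiagonal_eq_sum_range_succ
      (fun i _ ↦ (∑ ij ∈ antidiagonal i, u ij.1 * v ij.2) * 1) n]
    simp
  have hq : (1 - exp (-t)) ≠ 0 := by linarith
  rw [hprod, ← hparts]
  field_simp

/-- **The Abelian estimate for a product.** Let `|uₙ|, |vₙ| ≤ n + 1` and suppose
`|S_{uv}(n) − m n²/2| ≤ C (n+1)^α` for all `n`, with `α ≥ 1`, `m ≥ 0`. Then for `0 < t ≤ 1`,
`|F_u(t)F_v(t) − m (1 − e^{-t})^{-2}| ≤ (C + 2m) K(α) t^{-α}` (Bhowmik–Halupczok–Matsumoto–Suzuki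
§8, Step 1 with Lemma 13, at real `z = e^{-t}`; the tree's
`Literature.NumberTheory.LFunctions.exists_abs_laplaceSeries_sub_inv_le` is the case `u = v`).
[cite: BhowmikHalupczokMatsumotoSuzuki2019, §8 Step 1 and Lemma 13] -/
theorem abs_laplaceSeries_mul_sub_le (hu : ∀ n, |u n| ≤ (n : ℝ) + 1) (hv : ∀ n, |v n| ≤ (n : ℝ) + 1)
    {C α m : ℝ} (hα : 1 ≤ α) (hm : 0 ≤ m)
    (hS : ∀ n, |(∑ k ∈ range (n + 1), ∑ ij ∈ antidiagonal k, u ij.1 * v ij.2) - m * (n : ℝ) ^ 2 / 2| ≤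
      C * ((n : ℝ) + 1) ^ α) {t : ℝ} (ht : 0 < t) (ht1 : t ≤ 1) :
    |laplaceSeries u t * laplaceSeries v t - m * (1 - exp (-t))⁻¹ ^ 2| ≤
      (C + 2 * m) * geomWeightConst α * t ^ (-α) := by
  have hC : 0 ≤ C := by
    have := (abs_nonneg _).trans (hS 0)
    simpa using this
  have hα0 : 0 ≤ α := by linarith
  set K := geomWeightConst α with hK
  have hK0 : 0 ≤ K := geomWeightConst_nonneg α
  -- the two product identities
  have hb1 : ∀ n : ℕ, |(1 : ℝ)| ≤ 1 * ((n : ℝ) + 1) ^ 0 := fun n ↦ by simp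
  obtain ⟨hSuv, hPuv⟩ := laplaceSeries_mul hu hv ht
  obtain ⟨hS1, hK1⟩ := laplaceSeries_sq zero_le_one hb1 ht
  rw [laplaceSeries_one ht] at hK1
  obtain ⟨hWs, hW⟩ := tsum_pow_succ_rpow_mul_exp_le hα0 ht ht1
  obtain ⟨hq1, hq2, hq3⟩ := one_sub_exp_neg_bounds ht ht1
  set q : ℝ := 1 - exp (-t) with hq
  have hq0 : 0 < q := by linarith
  -- the difference of the summatory functions
  have hdiff : ∀ n : ℕ, |(∑ k ∈ range (n + 1), ∑ ij ∈ antidiagonal k, u ij.1 * v ij.2) -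
      m * selfConvSum (fun _ ↦ 1) n| ≤ (C + 2 * m) * ((n : ℝ) + 1) ^ α := by
    intro n
    have h1 := hS n
    have h2 := abs_selfConvSum_one_sub_le n
    have h3 : (n : ℝ) + 1 ≤ ((n : ℝ) + 1) ^ α := by
      calc (n : ℝ) + 1 = ((n : ℝ) + 1) ^ (1 : ℝ) := (rpow_one _).symm
        _ ≤ ((n : ℝ) + 1) ^ α :=
          rpow_le_rpow_of_exponent_le (by linarith [n.cast_nonneg (α := ℝ)]) hα
    calc |(∑ k ∈ range (n + 1), ∑ ij ∈ antidiagonal k, u ij.1 * v ij.2) -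
          m * selfConvSum (fun _ ↦ 1) n|
        = |((∑ k ∈ range (n + 1), ∑ ij ∈ antidiagonal k, u ij.1 * v ij.2) - m * (n : ℝ) ^ 2 / 2) -
            m * (selfConvSum (fun _ ↦ 1) n - (n : ℝ) ^ 2 / 2)| := by ring_nf
      _ ≤ |(∑ k ∈ range (n + 1), ∑ ij ∈ antidiagonal k, u ij.1 * v ij.2) - m * (n : ℝ) ^ 2 / 2| +
            |m * (selfConvSum (fun _ ↦ 1) n - (n : ℝ) ^ 2 / 2)| := abs_sub _ _
      _ ≤ C * ((n : ℝ) + 1) ^ α + m * (2 * ((n : ℝ) + 1)) := by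
          rw [abs_mul, abs_of_nonneg hm]
          exact add_le_add h1 (mul_le_mul_of_nonneg_left h2 hm)
      _ ≤ C * ((n : ℝ) + 1) ^ α + m * (2 * ((n : ℝ) + 1) ^ α) := by gcongr
      _ = (C + 2 * m) * ((n : ℝ) + 1) ^ α := by ring
  -- `P − m/q² = q · D`
  set D : ℝ := ∑' n : ℕ, ((∑ k ∈ range (n + 1), ∑ ij ∈ antidiagonal k, u ij.1 * v ij.2) -
      m * selfConvSum (fun _ ↦ 1) n) * exp (-t * n) with hD
  have hm1 : Summable fun n : ℕ ↦ m * selfConvSum (fun _ ↦ (1 : ℝ)) n * exp (-t * n) := by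
    have := hS1.mul_left m
    refine this.congr fun n ↦ by ring
  have hT1 : ∑' n : ℕ, m * selfConvSum (fun _ ↦ (1 : ℝ)) n * exp (-t * n) =
      m * ∑' n : ℕ, selfConvSum (fun _ ↦ (1 : ℝ)) n * exp (-t * n) := by
    rw [← tsum_mul_left]; exact tsum_congr fun n ↦ by ring
  have hDsplit : D = (∑' n : ℕ, (∑ m ∈ range (n + 1), ∑ ij ∈ antidiagonal m, u ij.1 * v ij.2) *
      exp (-t * n)) - m * ∑' n : ℕ, selfConvSum (fun _ ↦ (1 : ℝ)) n * exp (-t * n) := by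
    rw [hD, ← hT1, ← hSuv.tsum_sub hm1]
    exact tsum_congr fun n ↦ by ring
  have hD_eq : laplaceSeries u t * laplaceSeries v t - m * q⁻¹ ^ 2 = q * D := by
    rw [hPuv, hK1, hDsplit]; ring
  have hDs : Summable fun n : ℕ ↦ ‖((∑ k ∈ range (n + 1), ∑ ij ∈ antidiagonal k, u ij.1 * v ij.2) -
      m * selfConvSum (fun _ ↦ 1) n) * exp (-t * n)‖ := by
    refine Summable.of_nonneg_of_le (fun n ↦ norm_nonneg _) (fun n ↦ ?_) (hWs.mul_left (C + 2 * m))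
    rw [norm_mul, norm_eq_abs, norm_eq_abs, abs_of_pos (exp_pos _), ← mul_assoc]
    exact mul_le_mul_of_nonneg_right (hdiff n) (exp_pos _).le
  have hD_le : |D| ≤ (C + 2 * m) * K * t ^ (-α) * t⁻¹ := by
    calc |D| ≤ ∑' n : ℕ, ‖((∑ k ∈ range (n + 1), ∑ ij ∈ antidiagonal k, u ij.1 * v ij.2) -
          m * selfConvSum (fun _ ↦ 1) n) * exp (-t * n)‖ := by
          rw [← norm_eq_abs]; exact norm_tsum_le_tsum_norm hDs
      _ ≤ ∑' n : ℕ, (C + 2 * m) * (((n : ℝ) + 1) ^ α * exp (-t * n)) := by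
          refine hDs.tsum_le_tsum (fun n ↦ ?_) (hWs.mul_left (C + 2 * m))
          rw [norm_mul, norm_eq_abs, norm_eq_abs, abs_of_pos (exp_pos _), ← mul_assoc]
          exact mul_le_mul_of_nonneg_right (hdiff n) (exp_pos _).le
      _ = (C + 2 * m) * ∑' n : ℕ, ((n : ℝ) + 1) ^ α * exp (-t * n) := tsum_mul_left
      _ ≤ (C + 2 * m) * (K * t ^ (-(α + 1))) := by gcongr
      _ = (C + 2 * m) * K * t ^ (-α) * t⁻¹ := by
          rw [neg_add, rpow_add ht, rpow_neg_one]; ring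
  rw [hD_eq, abs_mul, abs_of_pos hq0]
  calc q * |D| ≤ t * ((C + 2 * m) * K * t ^ (-α) * t⁻¹) := by gcongr
    _ = (C + 2 * m) * K * t ^ (-α) := by field_simp

/-! ### Elementary comparison of `e^{-t}/t` with `(1 − e^{-t})^{-1}` -/

/-- For `0 < t ≤ 1`: `|e^{-t}/t − (1 − e^{-t})^{-1}| ≤ 3`, `e^{-t}/t + (1 − e^{-t})^{-1} ≤ 3/t`,
hence `|(e^{-t}/t)² − (1 − e^{-t})^{-2}| ≤ 9/t`; and `e^{-t}/t ≥ 1/(3t)`. [folklore] -/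
theorem exp_div_bounds {t : ℝ} (ht : 0 < t) (ht1 : t ≤ 1) :
    |exp (-t) / t - (1 - exp (-t))⁻¹| ≤ 3 ∧
      |(exp (-t) / t) ^ 2 - (1 - exp (-t))⁻¹ ^ 2| ≤ 9 / t ∧
      1 / (3 * t) ≤ exp (-t) / t ∧ exp (-t) / t ≤ 1 / t := by
  obtain ⟨hq1, hq2, hq3⟩ := one_sub_exp_neg_bounds ht ht1
  set q : ℝ := 1 - exp (-t) with hq
  have hq0 : 0 < q := by linarith
  have he0 : 0 < exp (-t) := exp_pos _
  have he1 : exp (-t) ≤ 1 := by rw [hq] at hq1; linarith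
  -- `|1/q − 1/t| ≤ 2`
  have hqt : |q⁻¹ - 1 / t| ≤ 2 := by
    have : q⁻¹ - 1 / t = (t - q) / (q * t) := by field_simp
    rw [this, abs_div, abs_of_pos (mul_pos hq0 ht), abs_of_nonneg (by linarith),
      div_le_iff₀ (mul_pos hq0 ht)]
    nlinarith
  -- `|g − 1/t| ≤ 1` with `g = e^{-t}/t`
  have hgt : |exp (-t) / t - 1 / t| ≤ 1 := by
    rw [show exp (-t) / t - 1 / t = -(q / t) by rw [hq]; field_simp; ring, abs_neg,
      abs_of_nonneg (by positivity), div_le_one ht]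
    exact hq2
  have h1 : |exp (-t) / t - q⁻¹| ≤ 3 := by
    calc |exp (-t) / t - q⁻¹| = |(exp (-t) / t - 1 / t) - (q⁻¹ - 1 / t)| := by ring_nf
      _ ≤ |exp (-t) / t - 1 / t| + |q⁻¹ - 1 / t| := abs_sub _ _
      _ ≤ 1 + 2 := add_le_add hgt hqt
      _ = 3 := by norm_num
  have hg_le : exp (-t) / t ≤ 1 / t := div_le_div_of_nonneg_right he1 ht.le
  have hQ_le : q⁻¹ ≤ 2 / t := by
    rw [inv_eq_one_div, div_le_div_iff₀ hq0 ht]; linarith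
  have h2 : |(exp (-t) / t) ^ 2 - q⁻¹ ^ 2| ≤ 9 / t := by
    have hsum : |exp (-t) / t + q⁻¹| ≤ 3 / t := by
      rw [abs_of_pos (by positivity)]
      calc exp (-t) / t + q⁻¹ ≤ 1 / t + 2 / t := add_le_add hg_le hQ_le
        _ = 3 / t := by ring
    calc |(exp (-t) / t) ^ 2 - q⁻¹ ^ 2| = |exp (-t) / t - q⁻¹| * |exp (-t) / t + q⁻¹| := by
          rw [← abs_mul]; ring_nf
      _ ≤ 3 * (3 / t) := mul_le_mul h1 hsum (abs_nonneg _) (by norm_num)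
      _ = 9 / t := by ring
  have h3 : 1 / (3 * t) ≤ exp (-t) / t := by
    rw [div_le_div_iff₀ (by positivity) ht]
    have : (1 : ℝ) / 3 ≤ exp (-t) := by
      have h := Real.exp_neg_one_gt_d9.le
      have hmono : exp (-1) ≤ exp (-t) := exp_le_exp.mpr (by linarith)
      linarith
    nlinarith
  exact ⟨h1, h2, h3, hg_le⟩

/-! ### The Goldbach count in progressions as a pair convolution of `Λ_a`, `Λ_b` -/

/-- `G(n; q, a, b) = ∑_{i+j=n} Λ_a(i) Λ_b(j)` with `Λ_a = Λ · 1_{· ≡ a (q)}`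
(`ArithmeticFunction.vonMangoldt.residueClass`). [folklore] -/
theorem goldbachLambdaCountMod_eq (q a b n : ℕ) :
    goldbachLambdaCountMod q a b n =
      ∑ ij ∈ antidiagonal n, residueClass (a : ZMod q) ij.1 * residueClass (b : ZMod q) ij.2 := by
  unfold goldbachLambdaCountMod
  rw [Finset.sum_filter]
  refine Finset.sum_congr rfl fun ij _ ↦ ?_
  simp only [residueClass, Set.indicator_apply, Set.mem_setOf_eq, ZMod.natCast_eq_natCast_iff]
  by_cases h1 : ij.1 ≡ a [MOD q] <;> by_cases h2 : ij.2 ≡ b [MOD q] <;> simp [h1, h2]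

/-- `S(x; q, a, b) = ∑_{m ≤ x} ∑_{i+j=m} Λ_a(i) Λ_b(j)`. [folklore] -/
theorem goldbachLambdaSumMod_eq (q a b x : ℕ) :
    goldbachLambdaSumMod q a b x = ∑ m ∈ range (x + 1),
      ∑ ij ∈ antidiagonal m, residueClass (a : ZMod q) ij.1 * residueClass (b : ZMod q) ij.2 := by
  unfold goldbachLambdaSumMod
  simp_rw [goldbachLambdaCountMod_eq]

/-! ### From the averaged asymptotic to bounds for `E_a + E_b` on `(0, 1]` -/

variable {q : ℕ}

/-- `φ(q) ≥ 1` (for `q ≥ 1`). [folklore] -/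
theorem one_le_totient [NeZero q] : (1 : ℝ) ≤ (q.totient : ℝ) := by
  exact_mod_cast Nat.totient_pos.mpr (NeZero.pos q)

/-- **Product step.** If `|S(n; q, a, b) − n²/(2φ(q)²)| ≤ C (n+1)^α` for all `n` (`α ≥ 1`),
then for `0 < t ≤ 1`
`|F_a(t)F_b(t) − φ(q)^{-2}(1 − e^{-t})^{-2}| ≤ (C + 2/φ²) K(α) t^{-α}`
(`F_a(t) = ∑_{n ≡ a} Λ(n) e^{-nt}`). [cite: BhowmikHalupczokMatsumotoSuzuki2019, §8 Step 1 and Lemma 13] -/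
theorem abs_laplace_mul_sub_le [NeZero q] {a b : ℕ} {C α : ℝ} (hα : 1 ≤ α)
    (hS : ∀ n : ℕ, |goldbachLambdaSumMod q a b n - (n : ℝ) ^ 2 / (2 * (q.totient : ℝ) ^ 2)| ≤
      C * ((n : ℝ) + 1) ^ α) {t : ℝ} (ht : 0 < t) (ht1 : t ≤ 1) :
    |laplaceSeries (residueClass (a : ZMod q)) t * laplaceSeries (residueClass (b : ZMod q)) t -
        ((q.totient : ℝ) ^ 2)⁻¹ * (1 - exp (-t))⁻¹ ^ 2| ≤
      (C + 2 * ((q.totient : ℝ) ^ 2)⁻¹) * geomWeightConst α * t ^ (-α) := by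
  refine abs_laplaceSeries_mul_sub_le (abs_residueClass_le _) (abs_residueClass_le _) hα
    (by positivity) (fun n ↦ ?_) ht ht1
  rw [← goldbachLambdaSumMod_eq]
  have := hS n
  rwa [show ((q.totient : ℝ) ^ 2)⁻¹ * (n : ℝ) ^ 2 / 2 = (n : ℝ) ^ 2 / (2 * (q.totient : ℝ) ^ 2) by
    field_simp]

/-- **The sum `E_a + E_b` against the product `E_a E_b`.** If
`|F_a(t)F_b(t) − φ^{-2}(1−e^{-t})^{-2}| ≤ C₁ t^{-α}` on `(0, 1]` (`α ≥ 1`), then, writing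
`F_a = e^{-t}/(φt) + E_a`, `F_b = e^{-t}/(φt) + E_b`:
`|E_a(t) + E_b(t)| ≤ 3φ(C₁ + 9/φ²) t^{1−α} + 3φ t |E_a(t)| |E_b(t)|` for `0 < t ≤ 1`. [folklore] -/
theorem abs_errLaplace_add_le [NeZero q] {a b : ℕ} {C₁ α : ℝ} (hα : 1 ≤ α)
    (hP : ∀ t : ℝ, 0 < t → t ≤ 1 →
      |laplaceSeries (residueClass (a : ZMod q)) t * laplaceSeries (residueClass (b : ZMod q)) t -
        ((q.totient : ℝ) ^ 2)⁻¹ * (1 - exp (-t))⁻¹ ^ 2| ≤ C₁ * t ^ (-α))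
    {t : ℝ} (ht : 0 < t) (ht1 : t ≤ 1) :
    |(laplaceSeries (residueClass (a : ZMod q)) t - exp (-t) / ((q.totient : ℝ) * t)) +
        (laplaceSeries (residueClass (b : ZMod q)) t - exp (-t) / ((q.totient : ℝ) * t))| ≤
      3 * (q.totient : ℝ) * (C₁ + 9 * ((q.totient : ℝ) ^ 2)⁻¹) * t ^ (1 - α) +
        3 * (q.totient : ℝ) * t *
          (|laplaceSeries (residueClass (a : ZMod q)) t - exp (-t) / ((q.totient : ℝ) * t)| *
           |laplaceSeries (residueClass (b : ZMod q)) t - exp (-t) / ((q.totient : ℝ) * t)|) := by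
  obtain ⟨hgQ, hsq, hglow, hgup⟩ := exp_div_bounds ht ht1
  set φ : ℝ := (q.totient : ℝ) with hφ
  have hφ1 : 1 ≤ φ := one_le_totient
  have hφ0 : 0 < φ := by linarith
  set g : ℝ := exp (-t) / t with hg
  set Q : ℝ := (1 - exp (-t))⁻¹ with hQ
  set Fa := laplaceSeries (residueClass (a : ZMod q)) t with hFa
  set Fb := laplaceSeries (residueClass (b : ZMod q)) t with hFb
  set Ea := Fa - exp (-t) / (φ * t) with hEa
  set Eb := Fb - exp (-t) / (φ * t) with hEb
  have hEa' : Fa = g / φ + Ea := by rw [hEa, hg]; field_simp; ring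
  have hEb' : Fb = g / φ + Eb := by rw [hEb, hg]; field_simp; ring
  have hg0 : 0 < g := by rw [hg]; positivity
  -- the algebraic identity
  have hid : (Ea + Eb) * (g / φ) =
      (Fa * Fb - (φ ^ 2)⁻¹ * Q ^ 2) - (φ ^ 2)⁻¹ * (g ^ 2 - Q ^ 2) - Ea * Eb := by
    rw [hEa', hEb']; field_simp; ring
  have hPt := hP t ht ht1
  have htα : t⁻¹ ≤ t ^ (-α) := by
    rw [← rpow_neg_one]
    exact rpow_le_rpow_of_exponent_ge ht ht1 (by linarith)
  have hmid : |(φ ^ 2)⁻¹ * (g ^ 2 - Q ^ 2)| ≤ 9 * (φ ^ 2)⁻¹ * t ^ (-α) := by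
    rw [abs_mul, abs_of_pos (by positivity)]
    calc (φ ^ 2)⁻¹ * |g ^ 2 - Q ^ 2| ≤ (φ ^ 2)⁻¹ * (9 / t) := by gcongr
      _ = 9 * (φ ^ 2)⁻¹ * t⁻¹ := by ring
      _ ≤ 9 * (φ ^ 2)⁻¹ * t ^ (-α) := by gcongr
  have hbound : |(Ea + Eb) * (g / φ)| ≤ (C₁ + 9 * (φ ^ 2)⁻¹) * t ^ (-α) + |Ea| * |Eb| := by
    rw [hid]
    calc |Fa * Fb - (φ ^ 2)⁻¹ * Q ^ 2 - (φ ^ 2)⁻¹ * (g ^ 2 - Q ^ 2) - Ea * Eb|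
        ≤ |Fa * Fb - (φ ^ 2)⁻¹ * Q ^ 2 - (φ ^ 2)⁻¹ * (g ^ 2 - Q ^ 2)| + |Ea * Eb| := abs_sub _ _
      _ ≤ (|Fa * Fb - (φ ^ 2)⁻¹ * Q ^ 2| + |(φ ^ 2)⁻¹ * (g ^ 2 - Q ^ 2)|) + |Ea| * |Eb| := by
          rw [abs_mul]; exact add_le_add (abs_sub _ _) le_rfl
      _ ≤ (C₁ * t ^ (-α) + 9 * (φ ^ 2)⁻¹ * t ^ (-α)) + |Ea| * |Eb| :=
          add_le_add (add_le_add hPt hmid) le_rfl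
      _ = (C₁ + 9 * (φ ^ 2)⁻¹) * t ^ (-α) + |Ea| * |Eb| := by ring
  -- divide by `g/φ ≥ 1/(3φt)`
  have hgφ : 0 < g / φ := by positivity
  have hkey : |Ea + Eb| ≤ (φ / g) * ((C₁ + 9 * (φ ^ 2)⁻¹) * t ^ (-α) + |Ea| * |Eb|) := by
    rw [abs_mul, abs_of_pos hgφ] at hbound
    rw [div_mul_eq_mul_div, le_div_iff₀ hg0]
    calc |Ea + Eb| * g = |Ea + Eb| * (g / φ) * φ := by field_simp
      _ ≤ ((C₁ + 9 * (φ ^ 2)⁻¹) * t ^ (-α) + |Ea| * |Eb|) * φ :=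
          mul_le_mul_of_nonneg_right hbound hφ0.le
      _ = φ * ((C₁ + 9 * (φ ^ 2)⁻¹) * t ^ (-α) + |Ea| * |Eb|) := by ring
  have hφg : φ / g ≤ 3 * φ * t := by
    rw [div_le_iff₀ hg0]
    have : 1 ≤ 3 * t * g := by
      have h := mul_le_mul_of_nonneg_left hglow (by positivity : (0 : ℝ) ≤ 3 * t)
      rwa [show 3 * t * (1 / (3 * t)) = 1 by field_simp] at h
    nlinarith
  have hnonneg : 0 ≤ (C₁ + 9 * (φ ^ 2)⁻¹) * t ^ (-α) + |Ea| * |Eb| := by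
    have : 0 ≤ (C₁ + 9 * (φ ^ 2)⁻¹) * t ^ (-α) := by
      have h0 : 0 ≤ C₁ * t ^ (-α) := le_trans (abs_nonneg _) hPt
      have : (C₁ + 9 * (φ ^ 2)⁻¹) * t ^ (-α) = C₁ * t ^ (-α) + 9 * (φ ^ 2)⁻¹ * t ^ (-α) := by ring
      rw [this]; positivity
    positivity
  have ht1α : t * t ^ (-α) = t ^ (1 - α) := by
    rw [show (1 - α : ℝ) = 1 + -α by ring, rpow_add ht, rpow_one]
  calc |Ea + Eb| ≤ (φ / g) * ((C₁ + 9 * (φ ^ 2)⁻¹) * t ^ (-α) + |Ea| * |Eb|) := hkey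
    _ ≤ (3 * φ * t) * ((C₁ + 9 * (φ ^ 2)⁻¹) * t ^ (-α) + |Ea| * |Eb|) :=
        mul_le_mul_of_nonneg_right hφg hnonneg
    _ = 3 * φ * (C₁ + 9 * (φ ^ 2)⁻¹) * t ^ (1 - α) + 3 * φ * t * (|Ea| * |Eb|) := by
        rw [← ht1α]; ring

/-- **The square-root step (`a = b`).** If `|F_a(t)² − φ^{-2}(1−e^{-t})^{-2}| ≤ C₁ t^{-α}` on
`(0, 1]` (`α ≥ 1`), then `|E_a(t)| ≤ (2φC₁ + 3/φ) t^{1−α}` there: `F_a ≥ 0`, so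
`|φ(1−e^{-t})F_a − 1| ≤ |(φ(1−e^{-t})F_a)² − 1|` (Bhowmik–Halupczok–Matsumoto–Suzuki §8,
Step 1: "we can take the complex square root … the sign … is `+`" — on the real axis this is the
elementary inequality). [cite: BhowmikHalupczokMatsumotoSuzuki2019, §8 Step 1] -/
theorem abs_errLaplace_le_of_sq [NeZero q] {a : ℕ} {C₁ α : ℝ} (hα : 1 ≤ α)
    (hP : ∀ t : ℝ, 0 < t → t ≤ 1 →
      |laplaceSeries (residueClass (a : ZMod q)) t * laplaceSeries (residueClass (a : ZMod q)) t -
        ((q.totient : ℝ) ^ 2)⁻¹ * (1 - exp (-t))⁻¹ ^ 2| ≤ C₁ * t ^ (-α))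
    {t : ℝ} (ht : 0 < t) (ht1 : t ≤ 1) :
    |laplaceSeries (residueClass (a : ZMod q)) t - exp (-t) / ((q.totient : ℝ) * t)| ≤
      (2 * (q.totient : ℝ) * C₁ + 3 * (q.totient : ℝ)⁻¹) * t ^ (1 - α) := by
  obtain ⟨hgQ, -, -, -⟩ := exp_div_bounds ht ht1
  obtain ⟨hq1, hq2, hq3⟩ := one_sub_exp_neg_bounds ht ht1
  set φ : ℝ := (q.totient : ℝ) with hφ
  have hφ1 : 1 ≤ φ := one_le_totient
  have hφ0 : 0 < φ := by linarith
  set qt : ℝ := 1 - exp (-t) with hqt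
  have hqt0 : 0 < qt := by linarith
  set P := laplaceSeries (residueClass (a : ZMod q)) t with hP'
  have hP0 : 0 ≤ P := laplaceSeries_nonneg (fun n ↦ residueClass_nonneg _ n) t
  have hPt := hP t ht ht1
  have hC₁ : 0 ≤ C₁ * t ^ (-α) := le_trans (abs_nonneg _) hPt
  -- `|(φ qt P)² − 1| ≤ φ² t² C₁ t^{-α}`
  have hsq : |(φ * qt * P) ^ 2 - 1| ≤ φ ^ 2 * t ^ 2 * (C₁ * t ^ (-α)) := by
    have : (φ * qt * P) ^ 2 - 1 = φ ^ 2 * qt ^ 2 * (P * P - (φ ^ 2)⁻¹ * qt⁻¹ ^ 2) := by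
      field_simp
    rw [this, abs_mul, abs_of_pos (by positivity)]
    gcongr
  -- `|φ qt P − 1| ≤ |(φ qt P)² − 1|`
  have hlin : |φ * qt * P - 1| ≤ φ ^ 2 * t ^ 2 * (C₁ * t ^ (-α)) := by
    refine le_trans ?_ hsq
    have h1 : 1 ≤ φ * qt * P + 1 := by nlinarith [mul_nonneg (mul_pos hφ0 hqt0).le hP0]
    calc |φ * qt * P - 1| = |φ * qt * P - 1| * 1 := (mul_one _).symm
      _ ≤ |φ * qt * P - 1| * |φ * qt * P + 1| := by
          gcongr; rw [abs_of_pos (by linarith)]; exact h1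
      _ = |(φ * qt * P) ^ 2 - 1| := by rw [← abs_mul]; ring_nf
  -- `|P − 1/(φ qt)| ≤ 2 φ C₁ t^{1−α}`
  have ht1α : t * t ^ (-α) = t ^ (1 - α) := by
    rw [show (1 - α : ℝ) = 1 + -α by ring, rpow_add ht, rpow_one]
  have hmain : |P - qt⁻¹ / φ| ≤ 2 * φ * C₁ * t ^ (1 - α) := by
    have : P - qt⁻¹ / φ = (φ * qt * P - 1) / (φ * qt) := by field_simp
    rw [this, abs_div, abs_of_pos (mul_pos hφ0 hqt0), div_le_iff₀ (mul_pos hφ0 hqt0)]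
    calc |φ * qt * P - 1| ≤ φ ^ 2 * t ^ 2 * (C₁ * t ^ (-α)) := hlin
      _ = φ * C₁ * t ^ (1 - α) * (φ * t) := by rw [← ht1α]; ring
      _ ≤ φ * C₁ * t ^ (1 - α) * (φ * (2 * qt)) := by
          have : 0 ≤ φ * C₁ * t ^ (1 - α) := by
            rw [← ht1α]; have := mul_nonneg ht.le hC₁; nlinarith
          gcongr; linarith
      _ = 2 * φ * C₁ * t ^ (1 - α) * (φ * qt) := by ring
  -- `|qt⁻¹ − g| ≤ 3 ≤ 3 t^{1−α}`
  have hpow1 : 1 ≤ t ^ (1 - α) := one_le_rpow_of_pos_of_le_one_of_nonpos ht ht1 (by linarith)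
  calc |P - exp (-t) / (φ * t)| = |(P - qt⁻¹ / φ) + (qt⁻¹ - exp (-t) / t) / φ| := by
        congr 1; field_simp; ring
    _ ≤ |P - qt⁻¹ / φ| + |(qt⁻¹ - exp (-t) / t) / φ| := abs_add_le _ _
    _ ≤ 2 * φ * C₁ * t ^ (1 - α) + 3 / φ * t ^ (1 - α) := by
        refine add_le_add hmain ?_
        rw [abs_div, abs_of_pos hφ0, abs_sub_comm, div_le_iff₀ hφ0]
        calc |exp (-t) / t - qt⁻¹| ≤ 3 := hgQ
          _ ≤ 3 * t ^ (1 - α) := by nlinarith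
          _ = 3 / φ * t ^ (1 - α) * φ := by field_simp
    _ = (2 * φ * C₁ + 3 * φ⁻¹) * t ^ (1 - α) := by ring

/-! ### Units and characters -/

/-- A residue coprime to `q` is a unit of `ZMod q`. [folklore] -/
theorem isUnit_natCast_of_coprime {a : ℕ} (ha : a.Coprime q) : IsUnit (a : ZMod q) :=
  (ZMod.isUnit_iff_coprime a q).mpr ha

/-- `χ(c⁻¹) = χ(c)⁻¹ ≠ 0` for a unit `c` of `ZMod q`. [folklore] -/
theorem apply_inv_of_isUnit (χ : DirichletCharacter ℂ q) {c : ZMod q} (hc : IsUnit c) :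
    χ c ≠ 0 ∧ χ c⁻¹ = (χ c)⁻¹ := by
  have h1 : χ c⁻¹ * χ c = 1 := by rw [← map_mul, ZMod.inv_mul_of_unit c hc, map_one]
  have h0 : χ c ≠ 0 := fun h ↦ by simp [h] at h1
  exact ⟨h0, eq_inv_of_mul_eq_one_left h1⟩

/-- If `χ(a)⁻¹ + χ(b)⁻¹ = 0` for units `a, b`, then `χ(a) + χ(b) = 0`. [folklore] -/
theorem apply_add_apply_eq_zero (χ : DirichletCharacter ℂ q) {a b : ZMod q} (ha : IsUnit a)
    (hb : IsUnit b) (h : χ a⁻¹ + χ b⁻¹ = 0) : χ a + χ b = 0 := by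
  obtain ⟨ha0, hainv⟩ := apply_inv_of_isUnit χ ha
  obtain ⟨hb0, hbinv⟩ := apply_inv_of_isUnit χ hb
  rw [hainv, hbinv] at h
  have : χ a + χ b = ((χ a)⁻¹ + (χ b)⁻¹) * (χ a * χ b) := by field_simp; ring
  rw [this, h, zero_mul]

/-! ### The case `a = b`: `B_q ≤ d` -/

/-- **Bhowmik–Halupczok–Matsumoto–Suzuki, Theorem 1 (2), the case `a = b`** (with DZC):
if `S(x; q, a, a) = x²/(2φ(q)²) + O(x^{1+d+ε})` for every `ε > 0` (`d ≥ 1/2`), then every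
non-trivial zero of every `L(·, χ)`, `χ (mod q)`, has real part `≤ d`. Proof (replacing §8 of
the source, which excludes `B_q = 1` by Ruzsa's kernel argument and then invokes the general
case): on the real axis `F_a(t) = ∑_{n ≡ a} Λ(n)e^{-nt} ≥ 0`, so the product step and the
square-root step give `E_a(t) = F_a(t) − e^{-t}/(φt) = O(t^{-(d+ε)})`; the Mellin transform of
`2E_a` is then holomorphic on `Re s > d + ε`, and the Landau step under DZC
(`Literature.NumberTheory.LFunctions.LaplaceProgressions.apply_inv_add_apply_inv_eq_zero`) gives
`2χ(a)⁻¹ = 0` at any zero with `d + ε < Re ρ < 1`, which is absurd.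
[cite: BhowmikHalupczokMatsumotoSuzuki2019, Theorem 1 (2) and §8] -/
theorem zerosRealPartLE_of_self [NeZero q] {a : ℕ} (ha : a.Coprime q)
    (hDZC : DistinctZeroConjecture q) {d : ℝ} (hd : 1 / 2 ≤ d)
    (hS : ∀ ε : ℝ, 0 < ε →
      (fun x : ℕ ↦ goldbachLambdaSumMod q a a x - (x : ℝ) ^ 2 / (2 * (Nat.totient q : ℝ) ^ 2))
        =O[atTop] fun x : ℕ ↦ (x : ℝ) ^ (1 + d + ε)) :
    ZerosRealPartLE q d := by
  intro χ s hs h0 h1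
  by_contra hsd
  push Not at hsd
  set ε : ℝ := (s.re - d) / 2 with hε
  have hε0 : 0 < ε := by rw [hε]; linarith
  set α : ℝ := 1 + d + ε with hα
  have hα1 : 1 ≤ α := by rw [hα]; linarith
  obtain ⟨C, -, hC⟩ :=
    Literature.NumberTheory.Sieve.GoldbachAverage.exists_abs_le_succ_rpow_of_isBigO
      (by rw [hα] at hα1; linarith) (hS ε hε0)
  have hP := fun t (ht : 0 < t) (ht1 : t ≤ 1) ↦
    abs_laplace_mul_sub_le (q := q) (a := a) (b := a) hα1 hC ht ht1
  set K : ℝ := 2 * (q.totient : ℝ) * ((C + 2 * ((q.totient : ℝ) ^ 2)⁻¹) * geomWeightConst α) +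
    3 * (q.totient : ℝ)⁻¹ with hK
  have hE : ∀ t : ℝ, 0 < t → t ≤ 1 →
      |laplaceSeries (residueClass (a : ZMod q)) t - exp (-t) / ((q.totient : ℝ) * t)| ≤
        K * t ^ (1 - α) :=
    fun t ht ht1 ↦ abs_errLaplace_le_of_sq hα1 hP ht ht1
  have hO : (fun t : ℝ ↦ ((laplaceSeries (residueClass (a : ZMod q)) t -
      Real.exp (-t) / ((q.totient : ℝ) * t) +
      (laplaceSeries (residueClass (a : ZMod q)) t - Real.exp (-t) / ((q.totient : ℝ) * t)) : ℝ) : ℂ))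
      =O[𝓝[>] 0] fun t ↦ t ^ (-(α - 1)) := by
    refine IsBigO.of_bound (2 * K) ?_
    filter_upwards [Ioo_mem_nhdsGT one_pos] with t ht
    rw [Complex.norm_real, Real.norm_eq_abs, Real.norm_eq_abs,
      abs_of_pos (rpow_pos_of_pos ht.1 _), show -(α - 1) = 1 - α by ring]
    have h := hE t ht.1 ht.2.le
    calc _ ≤ |laplaceSeries (residueClass (a : ZMod q)) t - exp (-t) / ((q.totient : ℝ) * t)| +
          |laplaceSeries (residueClass (a : ZMod q)) t - exp (-t) / ((q.totient : ℝ) * t)| :=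
          abs_add_le _ _
      _ ≤ K * t ^ (1 - α) + K * t ^ (1 - α) := add_le_add h h
      _ = 2 * K * t ^ (1 - α) := by ring
  have ha' : IsUnit (a : ZMod q) := isUnit_natCast_of_coprime ha
  have hhalf : s ≠ 1 / 2 := by
    intro h; rw [h] at hsd; norm_num at hsd; linarith
  have key := apply_inv_add_apply_inv_eq_zero hDZC ha' ha' (θ := α - 1) (by rw [hα]; linarith)
    hO hs (by rw [hα, hε]; linarith) h1 hhalf
  have h2 := apply_add_apply_eq_zero χ ha' ha' key
  obtain ⟨ha0, -⟩ := apply_inv_of_isUnit χ ha'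
  exact ha0 (by linear_combination h2 / 2)

/-! ### The general case from the a-priori bound for `E_a` under a zero-free half-plane -/

/-- **Bhowmik–Halupczok–Matsumoto–Suzuki, Theorem 1 (2), general `a, b`, from the a-priori
bound.** Assume DZC, `χ(a) + χ(b) ≠ 0` for all `χ (mod q)`, the averaged asymptotic
`S(x; q, a, b) = x²/(2φ(q)²) + O(x^{1+d+ε})` for every `ε > 0`, that `B_q < 1` (the zeros do
not approach `Re s = 1`), and the a-priori bound: whenever all `L(·, χ)` mod `q` are zero-free on
`Re s > B` (`1/2 ≤ B`), `E_c(t) = O(t^{-μ})` on `(0, 1]` for every `μ > B` and every invertible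
`c`. Then `B_q ≤ d`. Proof: if a zero had real part `> d`, let `B = sup Re ρ ∈ (d, 1)`; with
`μ = B + (1−B)/4` the product step gives
`E_a + E_b = O(t^{-(d+ε)}) + O(t · t^{-2μ}) = O(t^{-θ})`, `θ = max(d+ε, 2μ−1) < B`, and the Landau
step at a zero with `Re ρ > θ` contradicts `χ(a) + χ(b) ≠ 0`. This is the source's deduction
"`F(s) − φ(q)^{-2}(s−2)^{-1}` analytic on `σ > 1 + d` … hence `B_q ≤ d` provided DZC, `B_q < 1`",
with the role of Theorem 2 (error `x^{2B_q}`) played by the product `E_a E_b`.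
[cite: BhowmikHalupczokMatsumotoSuzuki2019, Theorem 1 (2), Proposition 3 and §7] -/
theorem zerosRealPartLE_of_laplaceBound [NeZero q] {a b : ℕ} (ha : a.Coprime q) (hb : b.Coprime q)
    (hDZC : DistinctZeroConjecture q)
    (hab : ∀ χ : DirichletCharacter ℂ q, χ (a : ZMod q) + χ (b : ZMod q) ≠ 0)
    {d : ℝ} (hd : 1 / 2 ≤ d)
    (hS : ∀ ε : ℝ, 0 < ε →
      (fun x : ℕ ↦ goldbachLambdaSumMod q a b x - (x : ℝ) ^ 2 / (2 * (Nat.totient q : ℝ) ^ 2))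
        =O[atTop] fun x : ℕ ↦ (x : ℝ) ^ (1 + d + ε))
    (hsup : ¬ ZerosRealPartSupOne q)
    (hIII : ∀ c : ZMod q, IsUnit c → ∀ B μ : ℝ, 1 / 2 ≤ B → B < μ →
      (∀ (χ : DirichletCharacter ℂ q) (s : ℂ), χ.LFunction s = 0 → 0 < s.re → s.re < 1 →
        s.re ≤ B) →
      ∃ K : ℝ, ∀ t : ℝ, 0 < t → t ≤ 1 →
        |laplaceSeries (residueClass c) t - Real.exp (-t) / ((q.totient : ℝ) * t)| ≤ K * t ^ (-μ)) :
    ZerosRealPartLE q d := by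
  -- a zero-free strip below `Re s = 1`
  have hsup' : ∃ σ₁ : ℝ, σ₁ < 1 ∧ ∀ (χ : DirichletCharacter ℂ q) (s : ℂ), χ.LFunction s = 0 →
      σ₁ < s.re → s.re < 1 → False := by
    by_contra hcon
    push Not at hcon
    exact hsup fun σ hσ ↦ by
      obtain ⟨χ, s, hz, h1, h2, -⟩ := hcon σ hσ
      exact ⟨χ, s, hz, h1, h2⟩
  obtain ⟨σ₁, hσ₁, hzero⟩ := hsup'
  intro χ₀ s₀ hz₀ h0 h1
  by_contra hds
  push Not at hds
  -- the supremum `B` of the real parts of the non-trivial zeros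
  set Z : Set ℝ := {x | ∃ (χ : DirichletCharacter ℂ q) (s : ℂ), χ.LFunction s = 0 ∧ 0 < s.re ∧
    s.re < 1 ∧ s.re = x} with hZ
  have hZne : Z.Nonempty := ⟨s₀.re, χ₀, s₀, hz₀, h0, h1, rfl⟩
  have hZle : ∀ x ∈ Z, x ≤ σ₁ := by
    rintro x ⟨χ, s, hz, hs0, hs1, rfl⟩
    by_contra hx
    push Not at hx
    exact hzero χ s hz hx hs1
  have hZbdd : BddAbove Z := ⟨σ₁, hZle⟩
  set B : ℝ := sSup Z with hB
  have hB1 : B ≤ σ₁ := csSup_le hZne hZle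
  have hs₀B : s₀.re ≤ B := le_csSup hZbdd ⟨χ₀, s₀, hz₀, h0, h1, rfl⟩
  have hdB : d < B := by linarith
  have hBlt : B < 1 := by linarith
  have hhalfB : 1 / 2 ≤ B := by linarith
  have hzeros : ∀ (χ : DirichletCharacter ℂ q) (s : ℂ), χ.LFunction s = 0 → 0 < s.re →
      s.re < 1 → s.re ≤ B :=
    fun χ s hz hs0 hs1 ↦ le_csSup hZbdd ⟨χ, s, hz, hs0, hs1, rfl⟩
  -- parameters
  set μ : ℝ := B + (1 - B) / 4 with hμ
  have hBμ : B < μ := by rw [hμ]; linarith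
  obtain ⟨Ka, hKa⟩ := hIII (a : ZMod q) (isUnit_natCast_of_coprime ha) B μ hhalfB hBμ hzeros
  obtain ⟨Kb, hKb⟩ := hIII (b : ZMod q) (isUnit_natCast_of_coprime hb) B μ hhalfB hBμ hzeros
  set ε : ℝ := (B - d) / 2 with hε
  have hε0 : 0 < ε := by rw [hε]; linarith
  set α : ℝ := 1 + d + ε with hα
  have hα1 : 1 ≤ α := by rw [hα]; linarith
  obtain ⟨C, -, hC⟩ :=
    Literature.NumberTheory.Sieve.GoldbachAverage.exists_abs_le_succ_rpow_of_isBigO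
      (by rw [hα] at hα1; linarith) (hS ε hε0)
  have hP := fun t (ht : 0 < t) (ht1 : t ≤ 1) ↦
    abs_laplace_mul_sub_le (q := q) (a := a) (b := b) hα1 hC ht ht1
  set θ : ℝ := max (d + ε) (2 * μ - 1) with hθ
  have hθB : θ < B := by
    rw [hθ]; refine max_lt (by rw [hε]; linarith) (by rw [hμ]; linarith)
  have hθ0 : 0 < θ := lt_of_lt_of_le (by linarith) (le_max_left _ _)
  -- `E_a + E_b = O(t^{-θ})`
  set φ : ℝ := (q.totient : ℝ) with hφ
  have hφ1 : 1 ≤ φ := one_le_totient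
  set A : ℝ := 3 * φ * ((C + 2 * (φ ^ 2)⁻¹) * geomWeightConst α + 9 * (φ ^ 2)⁻¹) with hA
  set A' : ℝ := 3 * φ * (Ka * Kb) with hA'
  have hO : (fun t : ℝ ↦ ((laplaceSeries (residueClass (a : ZMod q)) t -
      Real.exp (-t) / ((q.totient : ℝ) * t) +
      (laplaceSeries (residueClass (b : ZMod q)) t - Real.exp (-t) / ((q.totient : ℝ) * t)) : ℝ) : ℂ))
      =O[𝓝[>] 0] fun t ↦ t ^ (-θ) := by
    refine IsBigO.of_bound (A + A') ?_
    filter_upwards [Ioo_mem_nhdsGT one_pos] with t ht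
    have ht0 := ht.1
    have ht1 := ht.2.le
    rw [Complex.norm_real, Real.norm_eq_abs, Real.norm_eq_abs, abs_of_pos (rpow_pos_of_pos ht0 _)]
    have hmain := abs_errLaplace_add_le (q := q) (a := a) (b := b) hα1 hP ht0 ht1
    have hEa := hKa t ht0 ht1
    have hEb := hKb t ht0 ht1
    have hprod : |laplaceSeries (residueClass (a : ZMod q)) t - exp (-t) / ((q.totient : ℝ) * t)| *
        |laplaceSeries (residueClass (b : ZMod q)) t - exp (-t) / ((q.totient : ℝ) * t)| ≤
        (Ka * t ^ (-μ)) * (Kb * t ^ (-μ)) :=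
      mul_le_mul hEa hEb (abs_nonneg _) ((abs_nonneg _).trans hEa)
    -- comparison of the powers of `t`
    have hpow1 : t ^ (1 - α) ≤ t ^ (-θ) :=
      rpow_le_rpow_of_exponent_ge ht0 ht1 (by
        rw [hα]; have := le_max_left (d + ε) (2 * μ - 1); rw [← hθ] at this; linarith)
    have hpow2 : t * (t ^ (-μ) * t ^ (-μ)) ≤ t ^ (-θ) := by
      have : t * (t ^ (-μ) * t ^ (-μ)) = t ^ (1 - 2 * μ) := by
        rw [← rpow_add ht0, ← rpow_one_add' ht0.le (by rw [hμ]; linarith)]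
        ring_nf
      rw [this]
      refine rpow_le_rpow_of_exponent_ge ht0 ht1 ?_
      have := le_max_right (d + ε) (2 * μ - 1); rw [← hθ] at this; linarith
    have hA0 : 0 ≤ A := by
      have h9 : 0 ≤ (C + 2 * (φ ^ 2)⁻¹) * geomWeightConst α := by
        have h := hP 1 one_pos le_rfl
        rw [Real.one_rpow, mul_one] at h
        exact (abs_nonneg _).trans h
      rw [hA]; positivity
    have hKK : 0 ≤ Ka * Kb * (t ^ (-μ) * t ^ (-μ)) := by
      have : Ka * Kb * (t ^ (-μ) * t ^ (-μ)) = (Ka * t ^ (-μ)) * (Kb * t ^ (-μ)) := by ring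
      rw [this]
      exact le_trans (mul_nonneg (abs_nonneg _) (abs_nonneg _)) hprod
    have hKaKb : 0 ≤ Ka * Kb := by
      by_contra hneg
      push Not at hneg
      have hpos : 0 < t ^ (-μ) * t ^ (-μ) := by positivity
      linarith [mul_neg_of_neg_of_pos hneg hpos, hKK]
    have hA'0 : 0 ≤ A' := by rw [hA']; positivity
    calc _ ≤ 3 * φ * ((C + 2 * (φ ^ 2)⁻¹) * geomWeightConst α + 9 * (φ ^ 2)⁻¹) * t ^ (1 - α) +
          3 * φ * t * (|laplaceSeries (residueClass (a : ZMod q)) t - exp (-t) / (φ * t)| *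
            |laplaceSeries (residueClass (b : ZMod q)) t - exp (-t) / (φ * t)|) := hmain
      _ ≤ A * t ^ (1 - α) + 3 * φ * t * ((Ka * t ^ (-μ)) * (Kb * t ^ (-μ))) := by
          rw [hA]; gcongr
      _ = A * t ^ (1 - α) + A' * (t * (t ^ (-μ) * t ^ (-μ))) := by rw [hA']; ring
      _ ≤ A * t ^ (-θ) + A' * t ^ (-θ) :=
          add_le_add (mul_le_mul_of_nonneg_left hpow1 hA0) (mul_le_mul_of_nonneg_left hpow2 hA'0)
      _ = (A + A') * t ^ (-θ) := by ring
  -- a zero with real part `> θ`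
  obtain ⟨x, ⟨χ₁, ρ, hρz, hρ0, hρ1, rfl⟩, hθρ⟩ := exists_lt_of_lt_csSup hZne hθB
  have hhalf : ρ ≠ 1 / 2 := by
    intro h
    have : θ < (1 / 2 : ℂ).re := h ▸ hθρ
    norm_num at this
    have : d + ε ≤ θ := le_max_left _ _
    linarith
  have key := apply_inv_add_apply_inv_eq_zero hDZC (isUnit_natCast_of_coprime ha)
    (isUnit_natCast_of_coprime hb) hθ0 hO hρz hθρ hρ1 hhalf
  exact hab χ₁ (apply_add_apply_eq_zero χ₁ (isUnit_natCast_of_coprime ha)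
    (isUnit_natCast_of_coprime hb) key)

end BHMS

/-! ### Theorem 1 (2) from the a-priori bound -/

open Literature.NumberTheory.LFunctions ArithmeticFunction.vonMangoldt in
/-- **Bhowmik–Halupczok–Matsumoto–Suzuki 2019, Theorem 1 (2), reduced to the a-priori bound.**
The named fact `BHMS2019_thm1_ii` ("`B_q ≤ d` or `B_q = 1`; and `B_q ≤ d` if `a = b`") follows
from the single remaining analytic input: for every modulus `q`, invertible residue `c` and
`1/2 ≤ B < μ`, if all `L(·, χ)` mod `q` are zero-free on `B < Re s < 1` then
`∑_{n ≡ c} Λ(n)e^{-nt} − e^{-t}/(φ(q)t) = O(t^{-μ})` on `(0, 1]` (the smoothed form of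
"`ψ(x; q, c) − x/φ(q) ≪ x^{B+ε}` under the quasi-GRH `Re ρ ≤ B`", by Mellin inversion and a
shift of contour). The case `a = b` (`BHMS.zerosRealPartLE_of_self`) does not use this input.
[cite: BhowmikHalupczokMatsumotoSuzuki2019, Theorem 1 (2)] -/
theorem BHMS2019_thm1_ii_of_laplaceBound
    (hIII : ∀ (q : ℕ) [NeZero q] (c : ZMod q), IsUnit c → ∀ B μ : ℝ, 1 / 2 ≤ B → B < μ →
      (∀ (χ : DirichletCharacter ℂ q) (s : ℂ), χ.LFunction s = 0 → 0 < s.re → s.re < 1 →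
        s.re ≤ B) →
      ∃ K : ℝ, ∀ t : ℝ, 0 < t → t ≤ 1 →
        |laplaceSeries (residueClass c) t - Real.exp (-t) / ((q.totient : ℝ) * t)| ≤
          K * t ^ (-μ)) :
    BHMS2019_thm1_ii := by
  intro q _ a b ha hb hDZC hab d hd _hd1 hS
  refine ⟨?_, fun heq ↦ ?_⟩
  · by_cases hsup : ZerosRealPartSupOne q
    · exact Or.inr hsup
    · exact Or.inl (BHMS.zerosRealPartLE_of_laplaceBound ha hb hDZC hab hd hS hsup (hIII q))
  · subst heq
    exact BHMS.zerosRealPartLE_of_self ha hDZC hd hS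

open Literature.NumberTheory.LFunctions in
/-- **Bhowmik–Halupczok–Matsumoto–Suzuki 2019, Theorem 1 (2)** — discharge of the named fact
`BHMS2019_thm1_ii`: for `(ab, q) = 1`, under the Distinct Zero Conjecture and
`χ(a) + χ(b) ≠ 0` for all `χ (mod q)`, if `S(x; q, a, b) = x²/(2φ(q)²) + O_q(x^{1+d+ε})` for every
`ε > 0` (`1/2 ≤ d < 1`), then `B_q ≤ d` or `B_q = 1`, and `B_q ≤ d` if `a = b`. Assembled from
`BHMS2019_thm1_ii_of_laplaceBound` and the a-priori bound
`Literature.NumberTheory.LFunctions.LaplaceProgressions.laplaceBound_of_zeroFree`; the proof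
replaces the source's explicit formula (Theorem 2) and §8 by Laplace transforms on the real axis
(see the module docstring). [cite: BhowmikHalupczokMatsumotoSuzuki2019, Theorem 1 (2)] -/
theorem BHMS2019_thm1_ii_holds : BHMS2019_thm1_ii :=
  BHMS2019_thm1_ii_of_laplaceBound fun q _ c hc B μ hB hBμ hz ↦
    LaplaceProgressions.laplaceBound_of_zeroFree q c hc B μ hB hBμ hz

end Literature.Barriers.Parity

end
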